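import Summits.QuantumFields.BalabanUV.T4Continuum.Support.NE7SoftOperatorInverses
import HarnessLib

/-!
# NE7BalabanSoftOperatorMass — BAŁABAN's SOFT OPERATOR WITH A FREE MASS COEFFICIENT: `softSymOpKa a = HessSym_W + D_W R(W) D_W* + a·Qbar*·Qbar` ([B9] (3.26) `Δ_a(U)` with
# print's `a` as a PARAMETER), its quadratic form, its symmetry, and — under the positivity letter (P_a) = [B9] Thm 3.11's statement — the named Green operator
# `softSymGreenKa`, the inverse `softSymDinvKa = (Qbar G Qbar*)⁻¹` and the constrained propagator `cGreenSymKa = G − GQbar*(QbarGQbar*)⁻¹QbarG` (which does not depend on `a` as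
# an operator on `ker Qbar`, but is written through `G_a`) (file 131 of the curved (APE), F202)

Cell `pub-balaban`, rung (B)+1 sub-cell t4, lineage `b2b-balaban-t4-ne7-p1` (CRUX PROVER NE7 #1 = OWNER of row NE7), generation 85; memo
`t4/b2b-balaban-t4-ne7-p1-g85/LAGRANGE-CARRIER.md` §6∕§9.  Over F192 `NE7BalabanSoftOperator`, F198 `NE7SoftOperatorInverses` (`invOfInjective`, `injective_of_posDef`,
`posDef_comp_inv_adjoint`, `qbarOpK_surjective`) BY NAME.
WHY (NORMALISATION, located this gen).  F192's `massK` hard-codes the coefficient `M⁻²` in front of `Qbar*Qbar` with the tree's UNWEIGHTED torus sums and the tree's `QbarIter`,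
which carries the unit-lattice factor `M = L^{j+1}` (row NE3's `norm_QbarIter_le_two_mul`; lineage #2's chart `Q_k = n⁻¹·(Qcoarse L)^[j]`); print's `a(L^jη)^{−2}Q*Q` with the
WEIGHTED `L²` adjoint is, in these sums, `a·M^{d−4}·Qbar*Qbar` — so F192's mass is print's only up to `M^{d−4}`, and in `d = 4` it is `M⁻²`× too weak: the positivity letter of
F197∕F199 for THAT operator is stronger than [B9] Thm 3.11 (near-covariantly-constant modes: `hess_W ≈ −x·vol`, mass `≈ N^d`).  The constrained propagator is independent of the
mass coefficient; only the positivity letter cares.  THIS file makes `a` a PARAMETER so the END (successor file) can display (P_a) for print's own `a`.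
WHAT (DATA definitions + identities; [folklore]; 0 sorry).  §1 `massKa`, `softSymOpKa` (+ `softSymOpKa_apply` = F166's `hS` shape with `A = a·id`), `softSymOpKa_symm`,
`inner_softSymOpKa_self` (`= hess(b,b) + ⟪RD*b,RD*b⟫ + a⟪Qb b,Qb b⟫`), `softSymOpKa_posDef_of_lowerBound`.  §2 under (P_a): `softSymGreenKa` (`G_a = S_a⁻¹`), `qbar_greenA_adjoint_pos`,
`softSymDinvKa`, **`cGreenSymKa`**, with `softSymGreenKa_apply_softSymOpKa`, `softSymDinvKa_apply`.
HONEST FRAMING (page 1): DATA and algebra; NO estimate; (P_a) and the rows of `cGreenSymKa` are NOT proved; (KL-B) at curved `W` NOT proved; (APE) on curved data NOT proved; NOT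
ONE-STEP, NOT NE7; spine 0∕9; finite T⁴ rung (B)+1 — NOT infinite volume, NOT mass gap, NOT `BetaPertH`, NOT Clay.  Continuum YM on T⁴ ⇐ BetaPertH ∧ nine spine estimates (0/9
proved); BetaPertH ⇐ (D1) ∧ (D4) ∧ CAP+tail; G-an2-4 gates asym, D1 and NE2/3/4.
-/

set_option autoImplicit false

open scoped BigOperators InnerProductSpace Matrix Matrix.Norms.L2Operator
open Finset

namespace Summit.QuantumFields.BalabanUV.T4Continuum.NE7BalabanSoftOperatorMass

open Literature.MathematicalPhysics.QuantumFieldTheory.Balaban1983to89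
open B7Prop1Explicit B7Prop2Explicit UnitaryModel
open T4AveragingDeficitWall (IsUnitaryCfg IsSkewDir SmallField)
open T4AveragingDeficitWallBoundary (periodBox IsPeriodicCfg)
open AveragingDeficitMultiLevelPrep (LevelSmall)
open MinimalActionLevels (perWin)
open NE3HessForm (hess)
open NE3HilbertSchmidtTorus
open NE3QbarIterCovLiftPrep (cruxC)
open NE7ConstrainedGreenIdentity (constrainedGreen)
open NE7BalabanSoftOperator
open NE7SoftOperatorInverses (invOfInjective injective_of_posDef invOfInjective_apply_self self_invOfInjective_apply posDef_comp_inv_adjoint qbarOpK_surjective)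

noncomputable section

variable {d : ℕ} {n : Type*} [Fintype n] [DecidableEq n]

section Carrier

variable [Nonempty n] {L N : ℕ} [NeZero N] (hL : 1 ≤ L) (j : ℕ) [NeZero (N * L ^ (j + 1))]
  {W : Site d → Fin d → (Matrix n n ℂ)ˣ} {x : ℝ} (hWu : IsUnitaryCfg W) (hWP : IsPeriodicCfg W ((N * L ^ (j + 1) : ℕ) : ℤ))
  (hx : 0 ≤ x) (hs : LevelSmall d L j x) (hWx : SmallField W x)

/-! ## §1 The soft operator with mass coefficient `a` -/

/-- **THE MASS TERM WITH COEFFICIENT `a`**: `a·Qbar*·Qbar`. A DATA definition. [folklore] -/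
def massKa (a : ℝ) : skewForms d n (N * L ^ (j + 1)) →ₗ[ℝ] skewForms d n (N * L ^ (j + 1)) :=
  a • ((LinearMap.adjoint (𝕜 := ℝ) (E := skewForms d n (N * L ^ (j + 1))) (F := skewForms d n N) (qbarOpK (N := N) hL j hWu hx hs hWx)
        : skewForms d n N →ₗ[ℝ] skewForms d n (N * L ^ (j + 1))) ∘ₗ qbarOpK (N := N) hL j hWu hx hs hWx)

/-- **BAŁABAN's `Δ_a(W)` WITH PRINT's COEFFICIENT AS A PARAMETER**: `softSymOpKa a = HessSym_W + D_W R(W) D_W* + a·Qbar*Qbar`. A DATA definition. [folklore] -/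
def softSymOpKa (a : ℝ) : skewForms d n (N * L ^ (j + 1)) →ₗ[ℝ] skewForms d n (N * L ^ (j + 1)) :=
  hessSymOpK W (N * L ^ (j + 1)) + gaugeFixK (L := L) (N := N) j hWu + massKa hL j hWu hx hs hWx a

/-- `softSymOpKa a y = HessSym y + D(R(D* y)) + Qbar*((a • id)(Qbar y))` — F166's `hS` shape with `A = a·id`. [folklore] -/
theorem softSymOpKa_apply (a : ℝ) (y : skewForms d n (N * L ^ (j + 1))) :
    softSymOpKa hL j hWu hx hs hWx a y
      = hessSymOpK W (N * L ^ (j + 1)) y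
        + gradOpK hWu (N * L ^ (j + 1)) (landauProjK L N (j + 1) W
            ((LinearMap.adjoint (𝕜 := ℝ) (E := skewSecs d n (N * L ^ (j + 1))) (F := skewForms d n (N * L ^ (j + 1))) (gradOpK hWu (N * L ^ (j + 1)))
                : skewForms d n (N * L ^ (j + 1)) →ₗ[ℝ] skewSecs d n (N * L ^ (j + 1))) y))
        + (LinearMap.adjoint (𝕜 := ℝ) (E := skewForms d n (N * L ^ (j + 1))) (F := skewForms d n N) (qbarOpK (N := N) hL j hWu hx hs hWx)
              : skewForms d n N →ₗ[ℝ] skewForms d n (N * L ^ (j + 1)))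
            ((a • LinearMap.id (R := ℝ) (M := skewForms d n N)) (qbarOpK (N := N) hL j hWu hx hs hWx y)) := by
  simp only [softSymOpKa, gaugeFixK, massKa, LinearMap.add_apply, LinearMap.comp_apply, LinearMap.smul_apply, LinearMap.id_apply, LinearMap.map_smul]

/-- **`softSymOpKa a` IS SELF-ADJOINT.** [folklore] -/
theorem softSymOpKa_symm (a : ℝ) (b c : skewForms d n (N * L ^ (j + 1))) :
    ⟪softSymOpKa hL j hWu hx hs hWx a b, c⟫_ℝ = ⟪b, softSymOpKa (N := N) hL j hWu hx hs hWx a c⟫_ℝ := by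
  rw [softSymOpKa_apply, softSymOpKa_apply, inner_add_left, inner_add_left, inner_add_right, inner_add_right]
  refine congrArg₂ (· + ·) (congrArg₂ (· + ·) ?_ ?_) ?_
  · rw [inner_hessSymOpK_left, real_inner_comm, inner_hessSymOpK_left, add_comm]
  · rw [← LinearMap.adjoint_inner_right (gradOpK hWu (N * L ^ (j + 1))), inner_landauProjK_left, ← LinearMap.adjoint_inner_left (gradOpK hWu (N * L ^ (j + 1)))]
  · rw [LinearMap.adjoint_inner_left, LinearMap.smul_apply, LinearMap.id_apply, LinearMap.smul_apply, LinearMap.id_apply, LinearMap.adjoint_inner_right,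
      real_inner_smul_left, real_inner_smul_right]

/-- **THE QUADRATIC FORM**: `⟪b, softSymOpKa a b⟫ = hess W (extF b) (extF b) + ⟪R D* b, R D* b⟫ + a·⟪Qbar b, Qbar b⟫` (squares as inner products). [folklore] -/
theorem inner_softSymOpKa_self (a : ℝ) (b : skewForms d n (N * L ^ (j + 1))) :
    ⟪b, softSymOpKa (N := N) hL j hWu hx hs hWx a b⟫_ℝ
      = hess W (extF (N * L ^ (j + 1)) (b : Form d n (N * L ^ (j + 1)))) (extF (N * L ^ (j + 1)) (b : Form d n (N * L ^ (j + 1)))) (perWin d (N * L ^ (j + 1)))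
        + ⟪landauProjK L N (j + 1) W
            ((LinearMap.adjoint (𝕜 := ℝ) (E := skewSecs d n (N * L ^ (j + 1))) (F := skewForms d n (N * L ^ (j + 1))) (gradOpK hWu (N * L ^ (j + 1)))
              : skewForms d n (N * L ^ (j + 1)) →ₗ[ℝ] skewSecs d n (N * L ^ (j + 1))) b),
           landauProjK L N (j + 1) W
            ((LinearMap.adjoint (𝕜 := ℝ) (E := skewSecs d n (N * L ^ (j + 1))) (F := skewForms d n (N * L ^ (j + 1))) (gradOpK hWu (N * L ^ (j + 1)))
              : skewForms d n (N * L ^ (j + 1)) →ₗ[ℝ] skewSecs d n (N * L ^ (j + 1))) b)⟫_ℝ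
        + a * ⟪qbarOpK (N := N) hL j hWu hx hs hWx b, qbarOpK (N := N) hL j hWu hx hs hWx b⟫_ℝ := by
  rw [softSymOpKa_apply, inner_add_right, inner_add_right]
  refine congrArg₂ (· + ·) (congrArg₂ (· + ·) ?_ ?_) ?_
  · rw [real_inner_comm, inner_hessSymOpK_left]; ring
  · rw [← LinearMap.adjoint_inner_left (gradOpK hWu (N * L ^ (j + 1)))]
    set c := (LinearMap.adjoint (𝕜 := ℝ) (E := skewSecs d n (N * L ^ (j + 1))) (F := skewForms d n (N * L ^ (j + 1))) (gradOpK hWu (N * L ^ (j + 1)))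
            : skewForms d n (N * L ^ (j + 1)) →ₗ[ℝ] skewSecs d n (N * L ^ (j + 1))) b
    conv_lhs => rw [← landauProjK_idem L N (j + 1) W c]
    rw [inner_landauProjK_left]
  · rw [LinearMap.adjoint_inner_right, LinearMap.smul_apply, LinearMap.id_apply, real_inner_smul_right]

/-- **(P_a) FROM A LOWER BOUND**: strict positivity of the three-term form on non-zero skew forms gives positivity of `softSymOpKa a`. [folklore] -/
theorem softSymOpKa_posDef_of_lowerBound (a : ℝ)
    (hlow : ∀ b : skewForms d n (N * L ^ (j + 1)), b ≠ 0 →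
      0 < hess W (extF (N * L ^ (j + 1)) (b : Form d n (N * L ^ (j + 1)))) (extF (N * L ^ (j + 1)) (b : Form d n (N * L ^ (j + 1)))) (perWin d (N * L ^ (j + 1)))
        + ⟪landauProjK L N (j + 1) W
            ((LinearMap.adjoint (𝕜 := ℝ) (E := skewSecs d n (N * L ^ (j + 1))) (F := skewForms d n (N * L ^ (j + 1))) (gradOpK hWu (N * L ^ (j + 1)))
              : skewForms d n (N * L ^ (j + 1)) →ₗ[ℝ] skewSecs d n (N * L ^ (j + 1))) b),
           landauProjK L N (j + 1) W
            ((LinearMap.adjoint (𝕜 := ℝ) (E := skewSecs d n (N * L ^ (j + 1))) (F := skewForms d n (N * L ^ (j + 1))) (gradOpK hWu (N * L ^ (j + 1)))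
              : skewForms d n (N * L ^ (j + 1)) →ₗ[ℝ] skewSecs d n (N * L ^ (j + 1))) b)⟫_ℝ
        + a * ⟪qbarOpK (N := N) hL j hWu hx hs hWx b, qbarOpK (N := N) hL j hWu hx hs hWx b⟫_ℝ) :
    ∀ b : skewForms d n (N * L ^ (j + 1)), b ≠ 0 → 0 < ⟪b, softSymOpKa (N := N) hL j hWu hx hs hWx a b⟫_ℝ := fun b hb => by
  rw [inner_softSymOpKa_self]; exact hlow b hb

/-! ## §2 Under (P_a): the Green operator, `(Qbar G Qbar*)⁻¹`, and `C_a(W)` -/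

/-- **`G_a = (softSymOpKa a)⁻¹`** under (P_a). A DATA definition. [folklore] -/
def softSymGreenKa (a : ℝ) (hpos : ∀ b : skewForms d n (N * L ^ (j + 1)), b ≠ 0 → 0 < ⟪b, softSymOpKa (N := N) hL j hWu hx hs hWx a b⟫_ℝ) :
    skewForms d n (N * L ^ (j + 1)) →ₗ[ℝ] skewForms d n (N * L ^ (j + 1)) :=
  invOfInjective _ (injective_of_posDef _ hpos)

/-- `G_a (S_a y) = y`. [folklore] -/
theorem softSymGreenKa_apply_softSymOpKa (a : ℝ) (hpos : ∀ b : skewForms d n (N * L ^ (j + 1)), b ≠ 0 → 0 < ⟪b, softSymOpKa (N := N) hL j hWu hx hs hWx a b⟫_ℝ)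
    (y : skewForms d n (N * L ^ (j + 1))) : softSymGreenKa hL j hWu hx hs hWx a hpos (softSymOpKa hL j hWu hx hs hWx a y) = y :=
  invOfInjective_apply_self _ _ y

/-- `S_a (G_a y) = y`. [folklore] -/
theorem softSymOpKa_apply_softSymGreenKa (a : ℝ) (hpos : ∀ b : skewForms d n (N * L ^ (j + 1)), b ≠ 0 → 0 < ⟪b, softSymOpKa (N := N) hL j hWu hx hs hWx a b⟫_ℝ)
    (y : skewForms d n (N * L ^ (j + 1))) : softSymOpKa hL j hWu hx hs hWx a (softSymGreenKa hL j hWu hx hs hWx a hpos y) = y :=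
  self_invOfInjective_apply _ _ y

include hWP in
/-- `Qbar G_a Qbar*` is positive definite under (P_a) (`L ≥ 2`, `cruxC·M²·x < 1` for the surjectivity of `Qbar`). [folklore] -/
theorem qbar_greenA_adjoint_pos (hL2 : 2 ≤ L) (hθ : cruxC d L * (((L : ℝ) ^ (j + 1)) ^ 2 * x) < 1) (a : ℝ)
    (hpos : ∀ b : skewForms d n (N * L ^ (j + 1)), b ≠ 0 → 0 < ⟪b, softSymOpKa (N := N) hL j hWu hx hs hWx a b⟫_ℝ) (f : skewForms d n N) (hf : f ≠ 0) :
    0 < ⟪f, qbarOpK (N := N) hL j hWu hx hs hWx (softSymGreenKa hL j hWu hx hs hWx a hpos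
      ((LinearMap.adjoint (𝕜 := ℝ) (E := skewForms d n (N * L ^ (j + 1))) (F := skewForms d n N) (qbarOpK (N := N) hL j hWu hx hs hWx)
            : skewForms d n N →ₗ[ℝ] skewForms d n (N * L ^ (j + 1))) f))⟫_ℝ := by
  have h := posDef_comp_inv_adjoint (V := skewForms d n (N * L ^ (j + 1))) (F := skewForms d n N) (softSymOpKa hL j hWu hx hs hWx a)
    (softSymOpKa_symm hL j hWu hx hs hWx a) hpos (qbarOpK (N := N) hL j hWu hx hs hWx) (qbarOpK_surjective hL j hWu hWP hx hs hWx hL2 hθ) f hf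
  unfold softSymGreenKa
  exact h

include hWP in
/-- `Qbar G_a Qbar*` is injective under (P_a). [folklore] -/
theorem injective_qbar_greenA_adjoint (hL2 : 2 ≤ L) (hθ : cruxC d L * (((L : ℝ) ^ (j + 1)) ^ 2 * x) < 1) (a : ℝ)
    (hpos : ∀ b : skewForms d n (N * L ^ (j + 1)), b ≠ 0 → 0 < ⟪b, softSymOpKa (N := N) hL j hWu hx hs hWx a b⟫_ℝ) :
    Function.Injective (qbarOpK (N := N) hL j hWu hx hs hWx ∘ₗ softSymGreenKa hL j hWu hx hs hWx a hpos
      ∘ₗ (LinearMap.adjoint (𝕜 := ℝ) (E := skewForms d n (N * L ^ (j + 1))) (F := skewForms d n N) (qbarOpK (N := N) hL j hWu hx hs hWx)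
            : skewForms d n N →ₗ[ℝ] skewForms d n (N * L ^ (j + 1)))) :=
  injective_of_posDef _ fun f hf => by
    simpa only [LinearMap.comp_apply] using qbar_greenA_adjoint_pos hL j hWu hWP hx hs hWx hL2 hθ a hpos f hf

/-- **`(Qbar G_a Qbar*)⁻¹`** under (P_a). A DATA definition. [folklore] -/
def softSymDinvKa (hWP : IsPeriodicCfg W ((N * L ^ (j + 1) : ℕ) : ℤ)) (hL2 : 2 ≤ L) (hθ : cruxC d L * (((L : ℝ) ^ (j + 1)) ^ 2 * x) < 1) (a : ℝ)
    (hpos : ∀ b : skewForms d n (N * L ^ (j + 1)), b ≠ 0 → 0 < ⟪b, softSymOpKa (N := N) hL j hWu hx hs hWx a b⟫_ℝ) :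
    skewForms d n N →ₗ[ℝ] skewForms d n N :=
  invOfInjective _ (injective_qbar_greenA_adjoint hL j hWu hWP hx hs hWx hL2 hθ a hpos)

/-- `Dinv_a (Qbar (G_a (Qbar* f))) = f`. [folklore] -/
theorem softSymDinvKa_apply (hL2 : 2 ≤ L) (hθ : cruxC d L * (((L : ℝ) ^ (j + 1)) ^ 2 * x) < 1) (a : ℝ)
    (hpos : ∀ b : skewForms d n (N * L ^ (j + 1)), b ≠ 0 → 0 < ⟪b, softSymOpKa (N := N) hL j hWu hx hs hWx a b⟫_ℝ) (f : skewForms d n N) :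
    softSymDinvKa hL j hWu hx hs hWx hWP hL2 hθ a hpos (qbarOpK (N := N) hL j hWu hx hs hWx (softSymGreenKa hL j hWu hx hs hWx a hpos
      ((LinearMap.adjoint (𝕜 := ℝ) (E := skewForms d n (N * L ^ (j + 1))) (F := skewForms d n N) (qbarOpK (N := N) hL j hWu hx hs hWx)
            : skewForms d n N →ₗ[ℝ] skewForms d n (N * L ^ (j + 1))) f))) = f :=
  invOfInjective_apply_self _ (injective_qbar_greenA_adjoint hL j hWu hWP hx hs hWx hL2 hθ a hpos) f

/-- **BAŁABAN's CONSTRAINED PROPAGATOR `C_a(W) = G_a − G_aQbar*(QbarG_aQbar*)⁻¹QbarG_a`** under (P_a). A DATA definition. [folklore] -/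
def cGreenSymKa (hWP : IsPeriodicCfg W ((N * L ^ (j + 1) : ℕ) : ℤ)) (hL2 : 2 ≤ L) (hθ : cruxC d L * (((L : ℝ) ^ (j + 1)) ^ 2 * x) < 1) (a : ℝ)
    (hpos : ∀ b : skewForms d n (N * L ^ (j + 1)), b ≠ 0 → 0 < ⟪b, softSymOpKa (N := N) hL j hWu hx hs hWx a b⟫_ℝ) :
    skewForms d n (N * L ^ (j + 1)) →ₗ[ℝ] skewForms d n (N * L ^ (j + 1)) :=
  constrainedGreen (softSymGreenKa hL j hWu hx hs hWx a hpos) (qbarOpK (N := N) hL j hWu hx hs hWx)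
    (LinearMap.adjoint (𝕜 := ℝ) (E := skewForms d n (N * L ^ (j + 1))) (F := skewForms d n N) (qbarOpK (N := N) hL j hWu hx hs hWx)
        : skewForms d n N →ₗ[ℝ] skewForms d n (N * L ^ (j + 1)))
    (softSymDinvKa hL j hWu hx hs hWx hWP hL2 hθ a hpos)

end Carrier

end

end Summit.QuantumFields.BalabanUV.T4Continuum.NE7BalabanSoftOperatorMass
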